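import Summits.ResolutionOfSingularities.ResolutionOfSingularities.Theses.MaxContactCut
import Summits.ResolutionOfSingularities.ResolutionOfSingularities.Theses.OrderCut
import Summits.ResolutionOfSingularities.ResolutionOfSingularities.Theorems.MaxContactCutTauCut
import HarnessLib

/-!
# MaxContactCutExponentLadder — kernels of the decomp-res node «ExponentLadder» (lens-5 g7) BY NAME

Source HOME/decomp-res-lens-5/g7/ExponentLadder.lean (sha256 4710239ef67b3e2c, 255 lines; critic `lean check` rc 0 ·
0 sorry · 0 warnings · `closes` axioms standard), CRITIC-LEDGER row 44 (2026-08-30T06:45Z): CLEARED AS MAP NODE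
(score: residual 0 · decision 0 · map +1 — the dim-4 core `MaxContactCut.StepPICoreDimFour` 28544 is BISECTED by the
intrinsic exponent `e = v_p(n)` of the Benito–Villamayor presentation; critic's sharpening: under the typed
hyperplanar +
contact-free clause `In_y(G) ∩ k[Z] = k[Z^{p^{v_p(n)}}]`, so `e = v_p(n)` exactly).

Pieces = route asides of `Theses/MaxContactCut.lean` rev 7 (each = the parent VERBATIM with ONE hypothesis on `p ^
2 ∣ n`
inserted after `2 ≤ n →`): `StepPICoreShallowDimFour` 29781 [SHALLOW₄, `p² ∤ n`: UNDECIDED(T-shallow-lit), IDEA-NEEDED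
with adjacent print (Cossart–Piltant II, e = 1), NOT a prover target] · `StepPICoreDeepDimFour` 29782 [DEEP₄, `p² ∣
n`:
DECLARED RESIDUAL, score 0; KIT ASK T-moh-3 staged] refining 28544, and `StepPICoreShallow` 29783 · `StepPICoreDeep`
29784 refining the all-dimension core `StepPICore` 28538.

Kernels (0 sorry; excluded middle on `p ^ 2 ∣ n`, nothing else, then the landed `MaxContactCutTauCut` kernels BY
NAME):
`core_iff_shallow_and_deep` (28544 ⟺ 29781 ∧ 29782, EXACT), `core_iff_shallow_and_deep'` (28538 ⟺ 29783 ∧ 29784),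
`stepContactFreeDimFour_of_three'` / `_iff_three'` (28010 ⟺ 28543 ∧ SHALLOW₄ ∧ DEEP₄), the two LOCATIONS
(`pencilResolveDimFour_iff_deep_of_pocket_and_shallow`: modulo the pocket and SHALLOW₄,
`OrderCut.PencilResolveDimFour`
27135 ⟺ DEEP₄; and the symmetric one), `closes` (ROOT via `MaxContactCutTauCut.closes_tauCut`), `*_of_summit`
(every new piece is summit-implied), `pieces_of_summit`.  The lens's finite-range INSTRUMENTS
(`NoDivergentPointSequenceBaseThree`, `MohBoundExpOne` — fact candidate only) stay in the lens file and are not items.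
Why this is novel: the open dim-4 core is cut by an INTRINSIC arithmetic invariant of the order (`v_p(n)`),
separating the
regime with adjacent print (e ≤ 1) from the regime where Moh-type stability is open or fails one dimension up (e ≥ 2).
[Moh1987; CossartPiltant2019 Rem. 3.2; Benito–Villamayor arXiv:1004.1803 p. 3]
-/

namespace Summit.ResolutionOfSingularities.ResolutionOfSingularities.Theorems.MaxContactCutExponentLadder

open Summit.ResolutionOfSingularities.ResolutionOfSingularities.Theses
open Summit.ResolutionOfSingularities.ResolutionOfSingularities.Theorems

/-! ## Kernels, dimension 4 — excluded middle on `p ^ 2 ∣ n` -/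

/-- Necessity of SHALLOW₄ (29781) from the core 28544 (forget the extra hypothesis). -/
theorem shallow_of_core (h : MaxContactCut.StepPICoreDimFour) :
    MaxContactCut.StepPICoreShallowDimFour :=
  fun p hp k _ _ n hn _ => h p hp k n hn

/-- Necessity of DEEP₄ (29782) from the core 28544. -/
theorem deep_of_core (h : MaxContactCut.StepPICoreDimFour) :
    MaxContactCut.StepPICoreDeepDimFour :=
  fun p hp k _ _ n hn _ => h p hp k n hn

/-- The node's deciding kernel at the rung: SHALLOW₄ → DEEP₄ → `MaxContactCut.StepPICoreDimFour` (28544 BY NAME). -/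
theorem core_of_shallow_of_deep (hS : MaxContactCut.StepPICoreShallowDimFour)
    (hD : MaxContactCut.StepPICoreDeepDimFour) : MaxContactCut.StepPICoreDimFour := by
  intro p hp k _ _ n hn
  by_cases hd : p ^ 2 ∣ n
  · exact hD p hp k n hn hd
  · exact hS p hp k n hn hd

/-- **EXACTNESS**: `StepPICoreDimFour (28544) ⟺ StepPICoreShallowDimFour (29781) ∧ StepPICoreDeepDimFour (29782)`. -/
theorem core_iff_shallow_and_deep :
    MaxContactCut.StepPICoreDimFour ↔
      MaxContactCut.StepPICoreShallowDimFour ∧ MaxContactCut.StepPICoreDeepDimFour :=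
  ⟨fun h => ⟨shallow_of_core h, deep_of_core h⟩, fun h => core_of_shallow_of_deep h.1 h.2⟩

/-! ## Kernels, all dimensions -/

/-- Necessity of SHALLOW (29783) from the all-dimension core 28538. -/
theorem shallow_of_core' (h : MaxContactCut.StepPICore) : MaxContactCut.StepPICoreShallow :=
  fun p hp k _ _ n hn _ => h p hp k n hn

/-- Necessity of DEEP (29784) from the all-dimension core 28538. -/
theorem deep_of_core' (h : MaxContactCut.StepPICore) : MaxContactCut.StepPICoreDeep :=
  fun p hp k _ _ n hn _ => h p hp k n hn

/-- SHALLOW → DEEP → `MaxContactCut.StepPICore` (28538 BY NAME). -/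
theorem core_of_shallow_of_deep' (hS : MaxContactCut.StepPICoreShallow) (hD : MaxContactCut.StepPICoreDeep) :
    MaxContactCut.StepPICore := by
  intro p hp k _ _ n hn
  by_cases hd : p ^ 2 ∣ n
  · exact hD p hp k n hn hd
  · exact hS p hp k n hn hd

/-- **EXACTNESS (all dimensions)**: `StepPICore (28538) ⟺ StepPICoreShallow (29783) ∧ StepPICoreDeep (29784)`. -/
theorem core_iff_shallow_and_deep' :
    MaxContactCut.StepPICore ↔ MaxContactCut.StepPICoreShallow ∧ MaxContactCut.StepPICoreDeep :=
  ⟨fun h => ⟨shallow_of_core' h, deep_of_core' h⟩, fun h => core_of_shallow_of_deep' h.1 h.2⟩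

/-! ## Downstream BY NAME (MaxContactCutTauCut kernels, nothing re-proved) -/

/-- The contact-free dim-4 step (28010) from its three classes: τ ≥ 2 (28543), SHALLOW₄, DEEP₄. -/
theorem stepContactFreeDimFour_of_three' (hH : MaxContactCut.StepCFHigherDimFour)
    (hS : MaxContactCut.StepPICoreShallowDimFour) (hD : MaxContactCut.StepPICoreDeepDimFour) :
    MaxContactCut.StepContactFreeDimFour :=
  MaxContactCutTauCut.stepContactFreeDimFour_of_cfHigher_of_core hH (core_of_shallow_of_deep hS hD)

/-- Exactness one level up: `StepContactFreeDimFour (28010) ⟺ StepCFHigherDimFour (28543) ∧ SHALLOW₄ ∧ DEEP₄`. -/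
theorem stepContactFreeDimFour_iff_three' :
    MaxContactCut.StepContactFreeDimFour ↔
      MaxContactCut.StepCFHigherDimFour ∧ MaxContactCut.StepPICoreShallowDimFour ∧
        MaxContactCut.StepPICoreDeepDimFour := by
  rw [MaxContactCutTauCut.stepContactFreeDimFour_iff_cfHigher_and_core, core_iff_shallow_and_deep]

/-- **LOCATION**: modulo the pocket pieces (order bound 28006, order-one base 28008, contact class 28009, higher-type
class 28543) AND SHALLOW₄, the dim-4 pencil residual `OrderCut.PencilResolveDimFour` (27135) IS EXACTLY DEEP₄. -/
theorem pencilResolveDimFour_iff_deep_of_pocket_and_shallow (hB : MaxContactCut.OrderBound)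
    (h1 : MaxContactCut.LocalOrderOneResolveDimFour) (hC : MaxContactCut.StepContactDimFour)
    (hH : MaxContactCut.StepCFHigherDimFour) (hS : MaxContactCut.StepPICoreShallowDimFour) :
    OrderCut.PencilResolveDimFour ↔ MaxContactCut.StepPICoreDeepDimFour :=
  ⟨fun h => deep_of_core ((MaxContactCutTauCut.pencilResolveDimFour_iff_core_of_pocket hB h1 hC hH).mp h),
    fun hD => (MaxContactCutTauCut.pencilResolveDimFour_iff_core_of_pocket hB h1 hC hH).mpr
      (core_of_shallow_of_deep hS hD)⟩

/-- The symmetric location: modulo the pocket and DEEP₄, 27135 ⟺ SHALLOW₄. -/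
theorem pencilResolveDimFour_iff_shallow_of_pocket_and_deep (hB : MaxContactCut.OrderBound)
    (h1 : MaxContactCut.LocalOrderOneResolveDimFour) (hC : MaxContactCut.StepContactDimFour)
    (hH : MaxContactCut.StepCFHigherDimFour) (hD : MaxContactCut.StepPICoreDeepDimFour) :
    OrderCut.PencilResolveDimFour ↔ MaxContactCut.StepPICoreShallowDimFour :=
  ⟨fun h => shallow_of_core ((MaxContactCutTauCut.pencilResolveDimFour_iff_core_of_pocket hB h1 hC hH).mp h),
    fun hS => (MaxContactCutTauCut.pencilResolveDimFour_iff_core_of_pocket hB h1 hC hH).mpr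
      (core_of_shallow_of_deep hS hD)⟩

/-! ## Deciding theorem: the ROOT through `MaxContactCutTauCut.closes_tauCut` BY NAME -/

/-- **closes**: RegularRoofs (24573) → PencilReduction (27129) → OrderBound (28006) → LocalOrderOneResolve (27132) →
StepContact (28005) → StepCFHigher (28537) → StepPICoreShallow (29783) → StepPICoreDeep (29784) → the ROOT. -/
theorem closes (hR : MaxContactCut.RegularRoofs) (hP : MaxContactCut.PencilReduction)
    (hB : MaxContactCut.OrderBound) (h1 : MaxContactCut.LocalOrderOneResolve) (hC : MaxContactCut.StepContact)
    (hH : MaxContactCut.StepCFHigher) (hS : MaxContactCut.StepPICoreShallow) (hD : MaxContactCut.StepPICoreDeep) :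
    _root_.ResolutionOfSingularities :=
  MaxContactCutTauCut.closes_tauCut hR hP hB h1 hC hH (core_of_shallow_of_deep' hS hD)

/-! ## Necessity of every new piece from the ROOT (no piece is stronger than the summit) -/

/-- SHALLOW₄ (29781) is summit-implied. -/
theorem shallowDimFour_of_summit (h : _root_.ResolutionOfSingularities) :
    MaxContactCut.StepPICoreShallowDimFour :=
  shallow_of_core (MaxContactCutTauCut.stepPICoreDimFour_of_summit h)

/-- DEEP₄ (29782) is summit-implied. -/
theorem deepDimFour_of_summit (h : _root_.ResolutionOfSingularities) :
    MaxContactCut.StepPICoreDeepDimFour :=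
  deep_of_core (MaxContactCutTauCut.stepPICoreDimFour_of_summit h)

/-- SHALLOW (29783) is summit-implied. -/
theorem shallow_of_summit (h : _root_.ResolutionOfSingularities) : MaxContactCut.StepPICoreShallow :=
  shallow_of_core' (MaxContactCutTauCut.stepPICore_of_summit h)

/-- DEEP (29784) is summit-implied. -/
theorem deep_of_summit (h : _root_.ResolutionOfSingularities) : MaxContactCut.StepPICoreDeep :=
  deep_of_core' (MaxContactCutTauCut.stepPICore_of_summit h)

/-- All four new pieces are summit-implied. -/
theorem pieces_of_summit (h : _root_.ResolutionOfSingularities) :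
    MaxContactCut.StepPICoreShallow ∧ MaxContactCut.StepPICoreDeep ∧
      MaxContactCut.StepPICoreShallowDimFour ∧ MaxContactCut.StepPICoreDeepDimFour :=
  ⟨shallow_of_summit h, deep_of_summit h, shallowDimFour_of_summit h, deepDimFour_of_summit h⟩

end Summit.ResolutionOfSingularities.ResolutionOfSingularities.Theorems.MaxContactCutExponentLadder
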